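import Summits.AtomisticToContinuum.FouriersLaw.Theorems.EmbeddedDrudeMourreDrudeDissolutionStubForceKernelsIdentities
import Summits.AtomisticToContinuum.FouriersLaw.Theorems.EmbeddedDrudeMourreDrudeDissolutionStubHarmonicPencilAlgebra
import HarnessLib

/-!
# Stub KΦ `stub_forceKernels`: the pencil's algebra at the harmonic point and the force-kernel identities
(stub `stub_forceKernels` of line `gram-pencil-harmonic-chaos`, crux `EmbeddedDrudeMourre.DrudeDissolution`,
item stmt-AtomisticToContinuum-12593; `--supports` file, closes nothing)

WHAT. The registered sub-stub KΦ of the free-force-kernel theorem K of the line: the conjunction of KAlg (Wick products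
are local polynomials; `𝓛₀` is a derivation acting slot by slot through the lattice Klein–Gordon generator `L`;
`w_{Lf} = −iω w_f`; `C_T(Lf, g) = −C_T(f, Lg)`) with the force-kernel identities (an exact Wick presentation
`Φ = Σ_j c_j :φφφφ:(f_j) + Σ_j d_j :φφ:(g_j) + c₀` of the first-order force on the current along the coupling ray, whose
degree-2 chaos vector VANISHES — no Drude atom — and whose pair kernel is `A·i·[sin]·vertex/Πω` up to `Ω·bounded`,
`A = −3/4 ≠ 0`).

HOW. Both conjuncts are landed: KAlg is `stub_harmonicPencilAlgebra` (file `…StubHarmonicPencilAlgebra`), the identities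
are `forceKernelIdentities` (file `…StubForceKernelsIdentities`, with `…Waves`, `…Kernels`).
-/

noncomputable section

namespace Summit.AtomisticToContinuum.FouriersLaw.Theorems.DrudeDissolution.GramPencilHarmonicChaos

open MeasureTheory Filter Set Function Topology
open scoped InnerProductSpace ENNReal ComplexConjugate
open Literature.MathematicalPhysics.KineticTheory
open Literature.MathematicalPhysics.KineticTheory.HeatConduction
open Literature.MathematicalPhysics.KineticTheory.PhononBoltzmann
open HarmonicChaos ProbabilityTheory
open PinnedChainKinetic (𝕋 𝕋3 μ𝕋 μ𝕋3 k₄ sinT)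
open scoped Literature.MathematicalPhysics.KineticTheory.HeatConduction.PinnedChainKinetic

/-- **STUB KΦ** (L): KAlg and the Wick presentation / zero-momentum kernels of the first-order force `Φ`.
[cite: AokiLukkarinenSpohn2006, §3 eqs. (3.3), (3.15)–(3.17)] [cite: Janson1997, Thm 3.15] -/
theorem stub_forceKernels :
    ((∀ (ω₂ T : ℝ) (N : ℕ) (f : Fin N → TestFn), wick ω₂ T N f ∈ Algebra.adjoin ℝ (Set.range fun xc : ℤ × Bool => fun σ : ChainConfig => if xc.2 then (σ xc.1).2 else (σ xc.1).1)) ∧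
  (∀ (ω₂ γ T : ℝ), 0 < ω₂ → ∀ (N : ℕ) (f : Fin N → TestFn) (σ : ChainConfig),
      liouvilleZ (pinnedChain ω₂ 0 0 γ) (wick ω₂ T N f) σ =
        ∑ i : Fin N, wick ω₂ T N (Function.update f i ((-(ω₂ + 2)) • (f i).2 + Finsupp.mapDomain (fun x : ℤ => x + 1) (f i).2 + Finsupp.mapDomain (fun x : ℤ => x - 1) (f i).2, (f i).1)) σ) ∧
  (∀ (ω₂ T : ℝ), 0 < ω₂ → ∀ (f : TestFn) (k : 𝕋),
      thermalWave ω₂ T ((-(ω₂ + 2)) • f.2 + Finsupp.mapDomain (fun x : ℤ => x + 1) f.2 + Finsupp.mapDomain (fun x : ℤ => x - 1) f.2, f.1) k = -Complex.I * (PinnedChainKinetic.dispersion ω₂ k : ℂ) * thermalWave ω₂ T f k) ∧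
  (∀ (ω₂ T : ℝ), 0 < ω₂ → ∀ f g : TestFn,
      thermalCov ω₂ T ((-(ω₂ + 2)) • f.2 + Finsupp.mapDomain (fun x : ℤ => x + 1) f.2 + Finsupp.mapDomain (fun x : ℤ => x - 1) f.2, f.1) g = -thermalCov ω₂ T f ((-(ω₂ + 2)) • g.2 + Finsupp.mapDomain (fun x : ℤ => x + 1) g.2 + Finsupp.mapDomain (fun x : ℤ => x - 1) g.2, g.1))) ∧
    (∀ ω₂ a b : ℝ, 0 < ω₂ →
    ∃ (J : ℕ) (c : Fin J → ℝ) (f : Fin J → Fin 4 → TestFn) (J' : ℕ) (d : Fin J' → ℝ) (g : Fin J' → Fin 2 → TestFn) (c₀ : ℝ),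
      (∀ σ : ChainConfig, (fun σ : ChainConfig => liouvilleZ (pinnedChain ω₂ a b 1) (fun σ => (pinnedChain ω₂ 0 0 1).bondCurrentZ σ 0) σ - liouvilleZ (pinnedChain ω₂ 0 0 1) (fun σ => (pinnedChain ω₂ 0 0 1).bondCurrentZ σ 0) σ + b * (liouvilleZ (pinnedChain ω₂ 0 0 1) (fun σ => (pinnedChain ω₂ 0 1 1).bondCurrentZ σ 0) σ - liouvilleZ (pinnedChain ω₂ 0 0 1) (fun σ => (pinnedChain ω₂ 0 0 1).bondCurrentZ σ 0) σ)) σ =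
          (fun σ : ChainConfig => (∑ j : Fin J, c j * wick ω₂ 1 4 (f j) σ) + (∑ j : Fin J', d j * wick ω₂ 1 2 (g j) σ) + c₀) σ) ∧
      (∑ j : Fin J', (d j : ℂ) • wickVector ω₂ 1 (g j)) = 0 ∧
      (∃ A : ℝ, A ≠ 0 ∧ ∃ C : ℝ, ∀ κ : Shell 2 2,
          ‖(∑ j : Fin J, (c j : ℂ) * wickKernel ω₂ 1 (f j) 2 2 κ) -
              (A : ℂ) * Complex.I *
                ((sinT ((κ : SectorConfig 2 2).1 0) + sinT ((κ : SectorConfig 2 2).1 1) - sinT ((κ : SectorConfig 2 2).2 0) - sinT ((κ : SectorConfig 2 2).2 1) : ℝ) : ℂ) *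
                (PinnedChainKinetic.vertex a b ((κ : SectorConfig 2 2).1 0, (κ : SectorConfig 2 2).1 1, (κ : SectorConfig 2 2).2 0) : ℂ) /
                ((PinnedChainKinetic.dispersion ω₂ ((κ : SectorConfig 2 2).1 0) * PinnedChainKinetic.dispersion ω₂ ((κ : SectorConfig 2 2).1 1) * PinnedChainKinetic.dispersion ω₂ ((κ : SectorConfig 2 2).2 0) * PinnedChainKinetic.dispersion ω₂ ((κ : SectorConfig 2 2).2 1) : ℝ) : ℂ)‖ ≤
            C * |sectorPhase ω₂ κ|)) :=
  ⟨stub_harmonicPencilAlgebra, forceKernelIdentities⟩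

end Summit.AtomisticToContinuum.FouriersLaw.Theorems.DrudeDissolution.GramPencilHarmonicChaos

end
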